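import Mathlib.Geometry.Manifold.Diffeomorph
import Mathlib.Geometry.Manifold.ContMDiff.Basic
import HarnessLib

/-!
# Patching a diffeomorphism of complements with a local model

A generic gluing lemma for diffeomorphisms, used to pass from a *regluing diffeomorphism* defined
off a closed "wall" to a diffeomorphism of the whole manifolds (R. Gompf, *More Cappell–Shaneson
spheres are standard*, Algebr. Geom. Topol. 10 (2010), Lemma 2.2: "`X_N` is also obtained from `X`
by cutting out `D × T²` and regluing …"; here in the form needed for the model computation of the
proof of Thm 2.1):

* `Literature.Topology.FourManifolds.patchDiffeomorph` — given closed sets `W ⊆ V ⊆ Y`,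
  `W' ⊆ V' ⊆ Z` with `V, V'` open, a diffeomorphism `J : V ≃ V'` matching `W` with `W'`, and a
  diffeomorphism `Φ₀ : Y ∖ W ≃ Z ∖ W'` which agrees with `J` on `V ∖ W`, the map which is `J` on `V`
  and `Φ₀` off `W` is a diffeomorphism `Y ≃ Z` (`patchDiffeomorph_apply_of_mem`,
  `patchDiffeomorph_apply_of_not_mem`).

Everything is proved; no named facts.

## References

* R. E. Gompf, *More Cappell–Shaneson spheres are standard*, Algebr. Geom. Topol. 10 (2010)
  1665–1681, Lemma 2.2. [GompfAGT2010]
* M. W. Hirsch, *Differential Topology*, GTM 33 (1976), Ch. 8 §2 (gluing manifolds and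
  diffeomorphisms along open overlaps). [Hirsch1976]
-/

noncomputable section

open scoped Manifold ContDiff Topology
open Set Function Filter TopologicalSpace

namespace Literature.Topology.FourManifolds

section Patch

variable {E H : Type*} [NormedAddCommGroup E] [NormedSpace ℝ E] [TopologicalSpace H]
  {I : ModelWithCorners ℝ E H} {Y Z : Type*} [TopologicalSpace Y] [ChartedSpace H Y]
  [TopologicalSpace Z] [ChartedSpace H Z]

/-- The complement of a closed set as an open subset. [folklore] -/
def complOpens {W : Set Y} (hW : IsClosed W) : Opens Y := ⟨Wᶜ, hW.isOpen_compl⟩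

/-- Membership in `complOpens`. [folklore] -/
@[simp] theorem mem_complOpens {W : Set Y} (hW : IsClosed W) {p : Y} : p ∈ complOpens hW ↔ p ∉ W :=
  Iff.rfl

variable {W : Set Y} {W' : Set Z} (hW : IsClosed W) (hW' : IsClosed W') (V : Opens Y) (V' : Opens Z)

/-- **Data of a patch**: the local model `J : V ≃ V'` matching the walls, the diffeomorphism `Φ₀`
of the complements of the walls, and their agreement on `V ∖ W`. [folklore] -/
structure PatchData (I : ModelWithCorners ℝ E H) (hW : IsClosed W) (hW' : IsClosed W')
    (V : Opens Y) (V' : Opens Z) where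
  /-- The local model near the wall. -/
  J : V ≃ₘ⟮I, I⟯ V'
  /-- The diffeomorphism of the complements of the walls. -/
  Φ₀ : complOpens hW ≃ₘ⟮I, I⟯ complOpens hW'
  /-- The wall is inside the model domain. -/
  wall_subset : W ⊆ V
  /-- The target wall is inside the model range. -/
  wall_subset' : W' ⊆ V'
  /-- `J` matches the walls. -/
  mem_wall_iff : ∀ p : V, (p : Y) ∈ W ↔ (J p : Z) ∈ W'
  /-- `Φ₀ = J` on `V ∖ W`. -/
  agree : ∀ (p : Y) (hV : p ∈ V) (hW : p ∉ W), (Φ₀ ⟨p, hW⟩ : Z) = J ⟨p, hV⟩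

namespace PatchData

variable {hW hW' V V'} (D : PatchData I hW hW' V V')

open scoped Classical in
/-- The patched map: `J` on `V`, `Φ₀` off `V` (hence off `W`). [folklore] -/
def fwd (p : Y) : Z :=
  if h : p ∈ V then (D.J ⟨p, h⟩ : Z) else (D.Φ₀ ⟨p, fun hw ↦ h (D.wall_subset hw)⟩ : Z)

open scoped Classical in
/-- The patched inverse: `J⁻¹` on `V'`, `Φ₀⁻¹` off `V'`. [folklore] -/
def bwd (z : Z) : Y :=
  if h : z ∈ V' then (D.J.symm ⟨z, h⟩ : Y) else (D.Φ₀.symm ⟨z, fun hw ↦ h (D.wall_subset' hw)⟩ : Y)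

/-- On `V` the patched map is `J`. [folklore] -/
theorem fwd_of_mem {p : Y} (h : p ∈ V) : D.fwd p = D.J ⟨p, h⟩ := by
  classical
  rw [fwd, dif_pos h]

/-- Off `W` the patched map is `Φ₀`. [folklore] -/
theorem fwd_of_not_mem {p : Y} (h : p ∉ W) : D.fwd p = D.Φ₀ ⟨p, h⟩ := by
  classical
  by_cases hV : p ∈ V
  · rw [D.fwd_of_mem hV, ← D.agree p hV h]
  · rw [fwd, dif_neg hV]

/-- On `V'` the patched inverse is `J⁻¹`. [folklore] -/
theorem bwd_of_mem {z : Z} (h : z ∈ V') : D.bwd z = D.J.symm ⟨z, h⟩ := by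
  classical
  rw [bwd, dif_pos h]

/-- The two inverses agree on `V' ∖ W'`. [folklore] -/
theorem symm_agree {z : Z} (hV : z ∈ V') (hW : z ∉ W') :
    (D.Φ₀.symm ⟨z, hW⟩ : Y) = D.J.symm ⟨z, hV⟩ := by
  set q : V := D.J.symm ⟨z, hV⟩ with hq
  have hqW : (q : Y) ∉ W := fun h ↦ hW (by
    have := (D.mem_wall_iff q).1 h
    rwa [hq, Diffeomorph.apply_symm_apply] at this)
  have h1 : D.Φ₀ ⟨q, hqW⟩ = ⟨z, hW⟩ := by
    apply Subtype.ext
    rw [D.agree q q.2 hqW]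
    show ((D.J ⟨(q : Y), q.2⟩ : V') : Z) = z
    rw [Subtype.coe_eta, hq, Diffeomorph.apply_symm_apply]
  rw [← h1, Diffeomorph.symm_apply_apply]

/-- Off `W'` the patched inverse is `Φ₀⁻¹`. [folklore] -/
theorem bwd_of_not_mem {z : Z} (h : z ∉ W') : D.bwd z = D.Φ₀.symm ⟨z, h⟩ := by
  classical
  by_cases hV : z ∈ V'
  · rw [D.bwd_of_mem hV, D.symm_agree hV h]
  · rw [bwd, dif_neg hV]

/-- `bwd ∘ fwd = id`. [folklore] -/
theorem bwd_fwd (p : Y) : D.bwd (D.fwd p) = p := by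
  by_cases hV : p ∈ V
  · rw [D.fwd_of_mem hV, D.bwd_of_mem (D.J ⟨p, hV⟩).2, Subtype.coe_eta, Diffeomorph.symm_apply_apply]
  · have hWp : p ∉ W := fun hw ↦ hV (D.wall_subset hw)
    rw [D.fwd_of_not_mem hWp, D.bwd_of_not_mem (D.Φ₀ ⟨p, hWp⟩).2, Subtype.coe_eta,
      Diffeomorph.symm_apply_apply]

/-- `fwd ∘ bwd = id`. [folklore] -/
theorem fwd_bwd (z : Z) : D.fwd (D.bwd z) = z := by
  by_cases hV : z ∈ V'
  · rw [D.bwd_of_mem hV, D.fwd_of_mem (D.J.symm ⟨z, hV⟩).2, Subtype.coe_eta, Diffeomorph.apply_symm_apply]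
  · have hWz : z ∉ W' := fun hw ↦ hV (D.wall_subset' hw)
    rw [D.bwd_of_not_mem hWz, D.fwd_of_not_mem (D.Φ₀.symm ⟨z, hWz⟩).2, Subtype.coe_eta,
      Diffeomorph.apply_symm_apply]

/-- The patched map is smooth: on the open `V` it is `val ∘ J`, on the open `Y ∖ W` it is
`val ∘ Φ₀`. [folklore] -/
theorem contMDiff_fwd : ContMDiff I I ∞ D.fwd := by
  intro p
  by_cases hV : p ∈ V
  · have h : ContMDiff I I ∞ fun q : V ↦ D.fwd q := by
      have : (fun q : V ↦ D.fwd q) = Subtype.val ∘ D.J := funext fun q ↦ by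
        rw [comp_apply, D.fwd_of_mem q.2]
      rw [this]
      exact contMDiff_subtype_val.comp D.J.contMDiff
    exact (contMDiffAt_subtype_iff (U := V)).1 (h ⟨p, hV⟩) |> fun h' ↦ h'
  · have hWp : p ∉ W := fun hw ↦ hV (D.wall_subset hw)
    have h : ContMDiff I I ∞ fun q : complOpens hW ↦ D.fwd q := by
      have : (fun q : complOpens hW ↦ D.fwd q) = Subtype.val ∘ D.Φ₀ := funext fun q ↦ by
        rw [comp_apply, D.fwd_of_not_mem q.2]
      rw [this]
      exact contMDiff_subtype_val.comp D.Φ₀.contMDiff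
    exact (contMDiffAt_subtype_iff (U := complOpens hW)).1 (h ⟨p, hWp⟩)

/-- The patched inverse is smooth. [folklore] -/
theorem contMDiff_bwd : ContMDiff I I ∞ D.bwd := by
  intro z
  by_cases hV : z ∈ V'
  · have h : ContMDiff I I ∞ fun q : V' ↦ D.bwd q := by
      have : (fun q : V' ↦ D.bwd q) = Subtype.val ∘ D.J.symm := funext fun q ↦ by
        rw [comp_apply, D.bwd_of_mem q.2]
      rw [this]
      exact contMDiff_subtype_val.comp D.J.symm.contMDiff
    exact (contMDiffAt_subtype_iff (U := V')).1 (h ⟨z, hV⟩)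
  · have hWz : z ∉ W' := fun hw ↦ hV (D.wall_subset' hw)
    have h : ContMDiff I I ∞ fun q : complOpens hW' ↦ D.bwd q := by
      have : (fun q : complOpens hW' ↦ D.bwd q) = Subtype.val ∘ D.Φ₀.symm := funext fun q ↦ by
        rw [comp_apply, D.bwd_of_not_mem q.2]
      rw [this]
      exact contMDiff_subtype_val.comp D.Φ₀.symm.contMDiff
    exact (contMDiffAt_subtype_iff (U := complOpens hW')).1 (h ⟨z, hWz⟩)

/-- **Patching a diffeomorphism of complements with a local model.** [cite: GompfAGT2010, Lemma 2.2 (cut out and reglue); Hirsch1976 Ch. 8 §2] -/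
def patchDiffeomorph : Y ≃ₘ⟮I, I⟯ Z where
  toFun := D.fwd
  invFun := D.bwd
  left_inv := D.bwd_fwd
  right_inv := D.fwd_bwd
  contMDiff_toFun := D.contMDiff_fwd
  contMDiff_invFun := D.contMDiff_bwd

/-- On `V` the patched diffeomorphism is `J`. [folklore] -/
theorem patchDiffeomorph_apply_of_mem {p : Y} (h : p ∈ V) : D.patchDiffeomorph p = D.J ⟨p, h⟩ :=
  D.fwd_of_mem h

/-- Off `W` the patched diffeomorphism is `Φ₀`. [folklore] -/
theorem patchDiffeomorph_apply_of_not_mem {p : Y} (h : p ∉ W) : D.patchDiffeomorph p = D.Φ₀ ⟨p, h⟩ :=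
  D.fwd_of_not_mem h

end PatchData

end Patch

end Literature.Topology.FourManifolds
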